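import Mathlib
import Summits.ValiantsHypothesis.ValiantsHypothesis.Theorems.FifoMatchingNNNotVPCliqueProgramBasics
import HarnessLib

/-!
# Route FifoMatching — crux `NNNotVP` (stmt-ValiantsHypothesis-11615), line `division_split`:
# the clique token program ACCEPTS every clique vector

Companion of `…CliqueProgramDefs` / `…Basics`.

* `cliqueLab_run_cliqueVec` — for `k ≥ 1`, `R + 4 = 5k` and a `k`-set `Z` of vertices, the clique
  program `cliqueLab` (initial labels `lab0`) HAS a run on `cliqueVec Z`: the honest run in which
  token `i` guesses the `i`-th smallest element `z_i` of `Z`, every staged value is the left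
  neighbour's travelling value (all bucket filters met with equality; tokens never cross since
  blocks are monotone in the token and ties are side `0` before side `1`), and every CHECK tests
  two distinct members `z_i`, `z_{i-r}` of `Z`.

Honest framing: one half of "the clique program is a clique-like projection"; stub A follows in
the assembly companion; the crux `NNNotVP` and `VP ≠ VNP` stay OPEN (NOT proved).  No
definitions, no named facts.
-/

noncomputable section

-- Sub = Summit single-conjunct layout: the duplicated namespace component is mandated by the tree.
set_option linter.dupNamespace false

namespace Summit.ValiantsHypothesis.ValiantsHypothesis.Theorems.FifoMatching.NNNotVP.DivisionSplit

open Literature.Computability.Complexity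
open scoped Classical

/-! ### ACCEPT: the clique program has a run on a clique vector -/

section Accept

variable {k m : ℕ}

/-- The clique vector on an edge `{u, v}` is on iff both ends are in the set. [folklore] -/
theorem cliqueVec_mk_eq_true_iff (Z : Finset (Fin m)) (u v : Fin m)
    (h : s(u, v) ∈ (⊤ : SimpleGraph (Fin m)).edgeSet) :
    cliqueVec Z ⟨s(u, v), h⟩ = true ↔ u ∈ Z ∧ v ∈ Z := by
  simp [cliqueVec, Sym2.mem_iff]

/-- **ACCEPT.**  On the clique vector of a `k`-set `Z = {z₀ < ⋯ < z_{k-1}}` the clique program with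
`k ≥ 1` tokens and `R = 5k - 4` rounds HAS a run: the honest one — token `i` guesses `z_i`, every
staged value is the left neighbour's travelling value (so all bucket filters are met with
equality and no two tokens cross), and every CHECK tests two distinct members of `Z`.
[folklore] -/
theorem cliqueLab_run_cliqueVec (hk : 1 ≤ k) {R : ℕ} (hR : R + 4 = 5 * k) (Z : Finset (Fin m))
    (hZ : Z.card = k) :
    ∃ P : Fin R → Fin k → Pos k m, (∀ j, StrictMono (P j)) ∧
      (∀ i, Sum.elim (cliqueVec Z) id (lab0 i (P ⟨0, by omega⟩ i)) = true) ∧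
      ∀ (j : Fin R) (h : j.val + 1 < R) (i : Fin k),
        Sum.elim (cliqueVec Z) id (cliqueLab j (P j i) (P ⟨j.val + 1, h⟩ i)) = true := by
  -- the sorted clique
  let z : Fin k → Fin m := fun i => Z.orderEmbOfFin hZ i
  have hz : StrictMono z := fun i i' h => (Z.orderEmbOfFin hZ).strictMono h
  have hzZ : ∀ i, z i ∈ Z := fun i => Finset.orderEmbOfFin_mem Z hZ i
  -- travelling register after `r` macro-rounds, and the register states of the honest run
  let B : ℕ → Fin k → Fin (m + 1) := fun r i =>
    if h : i.val < r then Fin.last m else Fin.castSucc (z ⟨i.val - r, by omega⟩)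
  let W0 : ℕ → Fin k → Fin (regCard m) := fun r i =>
    mkRegs (z i) (B r i) (if r = 0 then Fin.last m else B r i)
  let W1 : ℕ → Fin k → Fin (regCard m) := fun r i =>
    mkRegs (z i) (B r i)
      (if i.val % 2 = 0 then (if r = 0 then Fin.last m else B r i) else B r ⟨i.val - 1, by omega⟩)
  let W3 : ℕ → Fin k → Fin (regCard m) := fun r i =>
    mkRegs (z i) (B r i) (if i.val = 0 then Fin.last m else B r ⟨i.val - 1, by omega⟩)
  -- blocks / sides of the two filter layouts
  let bE : Fin k → Fin k := fun i => ⟨i.val - i.val % 2, by omega⟩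
  let sE : Fin k → Fin 2 := fun i => ⟨i.val % 2, Nat.mod_lt _ (by omega)⟩
  let bO : Fin k → Fin k := fun i => ⟨i.val - (i.val + 1) % 2, by omega⟩
  let sO : Fin k → Fin 2 := fun i => ⟨(i.val + 1) % 2, Nat.mod_lt _ (by omega)⟩
  -- the honest run, by macro-round `r` and phase `s`
  let Q : ℕ → ℕ → Fin k → Pos k m := fun r s i =>
    if s = 0 then home i (W0 r i)
    else if s = 1 then filt (bE i) (B r (bE i)) (sE i) (W1 r i)
    else if s = 2 then filt (bE i) (revKey (B r (bE i))) (sE i) (W1 r i)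
    else if s = 3 then
      (if i.val = 0 then home i (W3 r i) else filt (bO i) (B r (bO i)) (sO i) (W3 r i))
    else
      (if i.val = 0 then filt i (revKey 0) 0 (W3 r i)
        else filt (bO i) (revKey (B r (bO i))) (sO i) (W3 r i))
  have hQ0 : ∀ r i, Q r 0 i = home i (W0 r i) := fun r i => by simp [Q]
  have hQ1 : ∀ r i, Q r 1 i = filt (bE i) (B r (bE i)) (sE i) (W1 r i) := fun r i => by
    simp [Q]
  have hQ2 : ∀ r i, Q r 2 i = filt (bE i) (revKey (B r (bE i))) (sE i) (W1 r i) := fun r i => by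
    simp [Q]
  have hQ3 : ∀ r i, Q r 3 i =
      (if i.val = 0 then home i (W3 r i) else filt (bO i) (B r (bO i)) (sO i) (W3 r i)) :=
    fun r i => by simp [Q]
  have hQ4 : ∀ r i, Q r 4 i =
      (if i.val = 0 then filt i (revKey 0) 0 (W3 r i)
        else filt (bO i) (revKey (B r (bO i))) (sO i) (W3 r i)) :=
    fun r i => by simp [Q]
  -- non-crossing of the layouts
  have monoE : ∀ (r : ℕ) (f : Fin (m + 1) → Fin (m + 1)) (W : Fin k → Fin (regCard m)),
      StrictMono (fun i => filt (bE i) (f (B r (bE i))) (sE i) (W i)) := by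
    intro r f W i i' h
    have hv : i.val < i'.val := h
    show filt (bE i) (f (B r (bE i))) (sE i) (W i) < filt (bE i') (f (B r (bE i'))) (sE i') (W i')
    by_cases hb : i.val - i.val % 2 < i'.val - i'.val % 2
    · exact filt_lt_filt_of_blk_lt (Fin.mk_lt_mk.2 hb) _ _ _ _ _ _
    · have he : bE i = bE i' := Fin.ext (by simp only [bE]; omega)
      rw [filt_lt_filt_iff]
      refine Or.inr ⟨he, Or.inr ⟨by rw [he], Or.inl ?_⟩⟩
      show (⟨i.val % 2, _⟩ : Fin 2) < ⟨i'.val % 2, _⟩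
      exact Fin.mk_lt_mk.2 (by omega)
  have monoO : ∀ (r : ℕ) (f : Fin (m + 1) → Fin (m + 1)) (q0 : Fin k → Pos k m),
      (∀ i : Fin k, i.val = 0 → blkOf (q0 i) = i) →
      StrictMono (fun i => if i.val = 0 then q0 i
        else filt (bO i) (f (B r (bO i))) (sO i) (W3 r i)) := by
    intro r f q0 hq0 i i' h
    have hv : i.val < i'.val := h
    have hi' : i'.val ≠ 0 := by omega
    show (if i.val = 0 then q0 i else filt (bO i) (f (B r (bO i))) (sO i) (W3 r i)) <
      (if i'.val = 0 then q0 i' else filt (bO i') (f (B r (bO i'))) (sO i') (W3 r i'))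
    rw [if_neg hi']
    by_cases hi : i.val = 0
    · rw [if_pos hi, ← filt_eta (q0 i), hq0 i hi]
      exact filt_lt_filt_of_blk_lt
        (Fin.lt_def.2 (by show i.val < i'.val - (i'.val + 1) % 2; omega)) _ _ _ _ _ _
    · rw [if_neg hi]
      by_cases hb : i.val - (i.val + 1) % 2 < i'.val - (i'.val + 1) % 2
      · exact filt_lt_filt_of_blk_lt (Fin.mk_lt_mk.2 hb) _ _ _ _ _ _
      · have he : bO i = bO i' := Fin.ext (by simp only [bO]; omega)
        rw [filt_lt_filt_iff]
        refine Or.inr ⟨he, Or.inr ⟨by rw [he], Or.inl ?_⟩⟩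
        show (⟨(i.val + 1) % 2, _⟩ : Fin 2) < ⟨(i'.val + 1) % 2, _⟩
        exact Fin.mk_lt_mk.2 (by omega)
  -- the run
  refine ⟨fun j i => Q (j.val / 5) (j.val % 5) i, fun j => ?_, fun i => ?_, fun j hj i => ?_⟩
  · -- non-crossing
    obtain ⟨j, hjR⟩ := j
    dsimp only
    have h5 : j % 5 = 0 ∨ j % 5 = 1 ∨ j % 5 = 2 ∨ j % 5 = 3 ∨ j % 5 = 4 := by omega
    rcases h5 with h | h | h | h | h <;> rw [h]
    · intro i i' hii'
      show Q _ 0 i < Q _ 0 i'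
      rw [hQ0, hQ0]
      exact filt_lt_filt_of_blk_lt hii' _ _ _ _ _ _
    · intro i i' hii'
      show Q _ 1 i < Q _ 1 i'
      rw [hQ1, hQ1]
      exact monoE _ id (W1 _) hii'
    · intro i i' hii'
      show Q _ 2 i < Q _ 2 i'
      rw [hQ2, hQ2]
      exact monoE _ revKey (W1 _) hii'
    · intro i i' hii'
      show Q _ 3 i < Q _ 3 i'
      rw [hQ3, hQ3]
      exact monoO (j / 5) id (fun i => home i (W3 (j / 5) i)) (fun i _ => rfl) hii'
    · intro i i' hii'
      show Q _ 4 i < Q _ 4 i'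
      rw [hQ4, hQ4]
      exact monoO (j / 5) revKey (fun i => filt i (revKey 0) 0 (W3 (j / 5) i)) (fun i _ => rfl) hii'
  · -- GUESS
    show Sum.elim (cliqueVec Z) id (lab0 i (Q (0 / 5) (0 % 5) i)) = true
    rw [Nat.zero_div, Nat.zero_mod, hQ0, lab0_on_iff]
    refine ⟨z i, ?_⟩
    simp only [W0, B, if_true, Nat.not_lt_zero, dif_neg, not_false_eq_true, Nat.sub_zero, Fin.eta]
  · -- the transitions
    obtain ⟨j, hjR⟩ := j
    dsimp only at hj ⊢
    have hBsucc : ∀ (r : ℕ) (i : Fin k) (hi : i.val ≠ 0),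
        B (r + 1) i = B r ⟨i.val - 1, by omega⟩ := by
      intro r i hi
      simp only [B]
      by_cases h : i.val < r + 1
      · rw [dif_pos h, dif_pos (by omega)]
      · rw [dif_neg h, dif_neg (by omega)]
        exact congrArg (fun t => Fin.castSucc (z t)) (Fin.ext (by dsimp only; omega))
    have h5 : j % 5 = 0 ∨ j % 5 = 1 ∨ j % 5 = 2 ∨ j % 5 = 3 ∨ j % 5 = 4 := by omega
    rw [cliqueLab_eq]
    dsimp only
    rcases h5 with h | h | h | h | h
    · -- round A
      rw [if_pos h, h, show (j + 1) / 5 = j / 5 by omega, show (j + 1) % 5 = 1 by omega, hQ0, hQ1]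
      rcases Nat.mod_two_eq_zero_or_one i.val with hpar | hpar
      · rw [labA_on_iff_even _ hpar]
        have hb : bE i = i := Fin.ext (by simp only [bE]; omega)
        have hs : sE i = 0 := Fin.ext (by simp only [sE]; omega)
        have hW : W1 (j / 5) i = W0 (j / 5) i := by simp only [W1, W0, hpar, if_true]
        rw [hb, hs, hW]
        simp only [W0, bOf_mkRegs]
      · rw [labA_on_iff_odd _ hpar]
        refine ⟨B (j / 5) ⟨i.val - 1, by omega⟩, ?_⟩
        have hb : bE i = ⟨i.val - 1, by omega⟩ := Fin.ext (by simp only [bE]; omega)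
        have hs : sE i = 1 := Fin.ext (by simp only [sE]; omega)
        rw [hb, hs]
        simp only [W1, W0, hpar, Nat.one_ne_zero, if_false, aOf_mkRegs, bOf_mkRegs]
    · -- round B
      rw [if_neg (by omega), if_pos h, h, show (j + 1) / 5 = j / 5 by omega,
        show (j + 1) % 5 = 2 by omega, hQ1, hQ2, labB_on_iff]
    · -- round C
      rw [if_neg (by omega), if_neg (by omega), if_pos h, h, show (j + 1) / 5 = j / 5 by omega,
        show (j + 1) % 5 = 3 by omega, hQ2, hQ3]
      rcases Nat.mod_two_eq_zero_or_one i.val with hpar | hpar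
      · have hb : bE i = i := Fin.ext (by simp only [bE]; omega)
        have hs : sE i = 0 := Fin.ext (by simp only [sE]; omega)
        rw [hb, hs]
        by_cases hi : i.val = 0
        · rw [if_pos hi, labC_on_iff_zero _ hi]
          simp only [W1, W3, hi, if_true, aOf_mkRegs, bOf_mkRegs]
        · rw [if_neg hi, labC_on_iff_pos _ hi]
          refine ⟨B (j / 5) ⟨i.val - 1, by omega⟩, ?_⟩
          have hb' : bO i = ⟨i.val - 1, by omega⟩ := Fin.ext (by simp only [bO]; omega)
          have hs' : sO i = 1 := Fin.ext (by simp only [sO]; omega)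
          rw [hb', hs']
          simp only [W1, W3, hpar, hi, if_true, if_false, aOf_mkRegs, bOf_mkRegs]
      · have hi : i.val ≠ 0 := by omega
        have hb : bE i = ⟨i.val - 1, by omega⟩ := Fin.ext (by simp only [bE]; omega)
        have hs : sE i = 1 := Fin.ext (by simp only [sE]; omega)
        rw [hb, hs, if_neg hi]
        have hbk : (⟨i.val - 1, by omega⟩ : Fin k).val + 1 < k := by dsimp only; omega
        rw [labC_on_iff_one _ hbk]
        have hb' : bO i = i := Fin.ext (by simp only [bO]; omega)
        have hs' : sO i = 0 := Fin.ext (by simp only [sO]; omega)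
        have hi' : (⟨(⟨i.val - 1, by omega⟩ : Fin k).val + 1, hbk⟩ : Fin k) = i :=
          Fin.ext (by dsimp only; omega)
        rw [hb', hs', hi']
        simp only [W1, W3, hpar, hi, Nat.one_ne_zero, if_false, bOf_mkRegs]
    · -- round D
      rw [if_neg (by omega), if_neg (by omega), if_neg (by omega), if_pos h, h,
        show (j + 1) / 5 = j / 5 by omega, show (j + 1) % 5 = 4 by omega, hQ3, hQ4]
      by_cases hi : i.val = 0
      · rw [if_pos hi, if_pos hi, home_eq, labB_on_iff]
      · rw [if_neg hi, if_neg hi, labB_on_iff]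
    · -- round E
      rw [if_neg (by omega), if_neg (by omega), if_neg (by omega), if_neg (by omega), h,
        show (j + 1) / 5 = j / 5 + 1 by omega, show (j + 1) % 5 = 0 by omega, hQ4, hQ0]
      by_cases hi : i.val = 0
      · rw [if_pos hi]
        have hbs : i.val + (0 : Fin 2).val < k := by simp
        rw [labE_on_iff _ hbs]
        have hi' : (⟨i.val + (0 : Fin 2).val, hbs⟩ : Fin k) = i := Fin.ext (by simp)
        rw [hi']
        have hB0 : B (j / 5 + 1) i = Fin.last m := by simp only [B]; rw [dif_pos (by omega)]
        simp only [W3, W0, hi, if_true, Nat.add_one_ne_zero, if_false, aOf_mkRegs, cOf_mkRegs,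
          hB0, chk_last, Sum.elim_inr, id, and_self]
      · rw [if_neg hi]
        have hbs : (bO i).val + (sO i).val < k := by simp only [bO, sO]; omega
        rw [labE_on_iff _ hbs]
        have hi' : (⟨(bO i).val + (sO i).val, hbs⟩ : Fin k) = i :=
          Fin.ext (by simp only [bO, sO]; omega)
        rw [hi']
        simp only [W3, W0, hi, if_false, Nat.add_one_ne_zero, aOf_mkRegs, cOf_mkRegs]
        rw [hBsucc _ i hi]
        refine ⟨rfl, ?_⟩
        -- the CHECK
        simp only [B]
        by_cases hlt : (⟨i.val - 1, by omega⟩ : Fin k).val < j / 5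
        · rw [dif_pos hlt, chk_last]; rfl
        · rw [dif_neg hlt, elim_chk_castSucc_iff]
          have hne : i ≠ ⟨(⟨i.val - 1, by omega⟩ : Fin k).val - j / 5, by dsimp only; omega⟩ := by
            intro he
            have := congrArg Fin.val he
            dsimp only at this hlt
            omega
          exact ⟨hz.injective.ne hne, (cliqueVec_mk_eq_true_iff Z _ _ _).2 ⟨hzZ _, hzZ _⟩⟩

end Accept

end Summit.ValiantsHypothesis.ValiantsHypothesis.Theorems.FifoMatching.NNNotVP.DivisionSplit

end
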